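import Literature.MathematicalPhysics.QuantumFieldTheory.Balaban1983to89.T3NestedUnitLaws
import Literature.MathematicalPhysics.QuantumFieldTheory.Balaban1983to89.T3UnitLawDensityEML
import Literature.MathematicalPhysics.QuantumFieldTheory.Balaban1983to89.T3UnitScaleTilt
import Literature.MathematicalPhysics.QuantumFieldTheory.Balaban1983to89.B12ContinuousTransportInvarianceOn
import HarnessLib

/-!
# Crux `BackwardStabilityAdmFR` (stmt-QuantumFields-28294, route `BackwardLiouvilleRigidity`, line «backward-lyapunov», stub `stub_lyapunovFR`):
# ONE BACKWARD STEP IS FREE IN THE SUP-RATIO (HILBERT-METRIC) CURRENCY — the first rung of the (P1) reader (unit ym-blr-lyapunov-reader-1, R625-ym)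

THE FACT (folklore; Birkhoff–Hopf: a positive linear operator does not expand the Hilbert projective metric).  Let two CONSISTENT towers
`μ_j = (descend F ℰp j)_* μ_{j+1}`, `μ′_j = (descend F ℰp j)_* μ′_{j+1}` have Haar densities `ρ_k, ρ′_k` (`μ_k = ρ_k·dU_k`).  If at the fine height
`j+1` the two densities are comparable EVERYWHERE, `e^c·ρ′_{j+1} ≤ ρ_{j+1} ≤ e^{c+a}·ρ′_{j+1}`, then the push-forward measures are comparable with
the SAME constants (`e^c·μ′_j ≤ μ_j ≤ e^{c+a}·μ′_j`, §1–§2: one line of measure theory, the renormalisation transform `(Tρ)(V) = ∫ dU δ(Ū V⁻¹) ρ(U)` of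
[Balaban1985Averaging] (10) p.19 in its push-forward reading is a positive operator), and on the small-field window `{PlaqSmall θ_j}` — where the crux's
hypotheses make `ρ_j, ρ′_j` positive and continuous and the product Haar measure on `SU(2)^{bonds}` charges open sets — the comparison holds POINTWISE
(§3, no measurability of the densities is needed: a strict violation on an open neighbourhood would give the window ball more `μ_j`-mass than
`e^{c+a}·μ′_j`-mass).  Consequently `c ≤ log ρ_j − log ρ′_j ≤ c + a` on the window and the one-bond (indeed any-two-points) oscillation of
`L_j := log ρ_j − log ρ′_j` there is `≤ a` (§4): in the currency `Φ_k := θ·(sup − inf of L_k)` the one-step clause of `stub_lyapunovFR` holds with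
`ε = 0, C = 0, δ = 0`, for EVERY consistent pair — in particular for the (P2) toy pair (the Wilson runs with finest levels `N`, `N+1` at `J = N`,
`j = N − 1`; §5 `toyPair_supRatio_oneStep` states it for that pair BY NAME, `gibbsK` ∕ `descend`), and §2 `tower_le_smul` iterates it down a whole tower.

HONEST SCOPE (the census half of the rung).  This is the TRIVIAL half of backward stability: the sup-ratio currency is GLOBAL, and the crux's top
domination `Φ_J ≤ θ·ω_J` FAILS in it — the clustered four-point ∕ one-bond input `ω_J` controls `sup − inf` of `L_J` over the window only after a
chain of `#PBond_J` one-bond moves, i.e. `Φ_J ≲ θ·#PBond_J·ω_J`, a volume factor the constants (chosen before `J`) cannot absorb.  The crux's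
content is exactly LOCALITY: the one-step law in the one-bond ∕ clustered four-point currency, where the top domination is free (✓`AdmFRTopHeight` §1)
and the step is the renormalisation-group analysis ([Balaban1985UV3] Thm 2; the KT-W one-time jump of the g13 card; instrument row kit j342110 of
this unit: Gaussian-caricature one-step ratios of the toy pair).  Nothing of 28294 ∕ 28296 ∕ `ClassLimitTrajectoriesAdmFR` is proved; rung R3
(`YM3TorusSU2`, finite-volume SU(2) YM₃ on T³ — not d = 4, not infinite volume, not a mass gap, not Clay) and every summit statement stay OPEN;
the Yang–Mills mass gap is NOT proved.
-/

namespace Summit.QuantumFields.YangMills.Theorems.BackwardLiouvilleRigidity.SupRatioStep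

open MeasureTheory Filter Topology
open scoped ENNReal
open Literature.MathematicalPhysics.QuantumFieldTheory.Balaban1983to89 T3ContinuumYM3Torus T3NestedUnitLaws T3UnitLawDensityEML
  T3UnitScaleTilt

/-! ## §1 Pointwise comparable densities give comparable measures; push-forwards keep the constant -/

/-- **COMPARABLE DENSITIES ⇒ COMPARABLE MEASURES**: if `ρ ≤ e^a·ρ′` pointwise then `ρ·m ≤ e^a·(ρ′·m)` (densities read through `ENNReal.ofReal`, as in
the route file; no measurability needed). [folklore] -/
theorem withDensity_ofReal_le_smul {X : Type*} [MeasurableSpace X] (m : Measure X) {ρ ρ' : X → ℝ} {a : ℝ}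
    (h : ∀ x, ρ x ≤ Real.exp a * ρ' x) :
    m.withDensity (fun x => ENNReal.ofReal (ρ x)) ≤
      ENNReal.ofReal (Real.exp a) • m.withDensity (fun x => ENNReal.ofReal (ρ' x)) := by
  rw [← withDensity_smul' _ _ ENNReal.ofReal_ne_top]
  refine withDensity_mono (Eventually.of_forall fun x => ?_)
  show ENNReal.ofReal (ρ x) ≤ ENNReal.ofReal (Real.exp a) * ENNReal.ofReal (ρ' x)
  rw [← ENNReal.ofReal_mul (Real.exp_pos a).le]
  exact ENNReal.ofReal_le_ofReal (h x)

/-- **PUSH-FORWARDS KEEP THE COMPARISON CONSTANT** (the renormalisation transform is a positive operator: `μ ≤ C·μ′ ⇒ d_*μ ≤ C·d_*μ′`).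
[cite: Balaban1985Averaging, (10) p.19] -/
theorem map_le_smul_map {X Y : Type*} [MeasurableSpace X] [MeasurableSpace Y] {μ μ' : Measure X} {d : X → Y}
    (hd : Measurable d) {C : ℝ≥0∞} (h : μ ≤ C • μ') : μ.map d ≤ C • μ'.map d := by
  rw [← Measure.map_smul]
  exact Measure.map_mono h hd

/-! ## §2 One backward step, and a whole tower, at the level of measures -/

/-- **ONE BACKWARD STEP AT THE LEVEL OF MEASURES**: for a consistent pair `μ_j = (descend F ℰp j)_* μ_{j+1}`, `μ′_j = (descend F ℰp j)_* μ′_{j+1}`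
on the d = 3 towers of a `T3Family` (group `SU(2)`, averaging of record `ℰp`), `μ_{j+1} ≤ C·μ′_{j+1} ⇒ μ_j ≤ C·μ′_j`.
[cite: Balaban1985Averaging, (10) p.19] -/
theorem descend_step_le_smul (F : T3Family) (j : ℕ)
    {μ₁ μ₁' : Measure (GaugeField (F.P (j + 1)) 0 (Matrix.specialUnitaryGroup (Fin 2) ℂ))}
    {μ₀ μ₀' : Measure (GaugeField (F.P j) 0 (Matrix.specialUnitaryGroup (Fin 2) ℂ))}
    (hc : μ₀ = Measure.map (descend F ℰp j) μ₁) (hc' : μ₀' = Measure.map (descend F ℰp j) μ₁')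
    {C : ℝ≥0∞} (h : μ₁ ≤ C • μ₁') : μ₀ ≤ C • μ₀' := by
  rw [hc, hc']
  exact map_le_smul_map (measurable_descend F ℰp measurableE_ℰp j) h

/-- **A WHOLE TOWER**: along consistent towers `μ_j = (descend F ℰp j)_* μ_{j+1}` (both), a comparison `μ_J ≤ C·μ′_J` at the top height `J`
descends to every height `j ≤ J` with the SAME constant. [cite: Balaban1985Averaging, (10) p.19] -/
theorem tower_le_smul (F : T3Family)
    (μ μ' : (j : ℕ) → Measure (GaugeField (F.P j) 0 (Matrix.specialUnitaryGroup (Fin 2) ℂ)))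
    (hc : ∀ j : ℕ, μ j = Measure.map (descend F ℰp j) (μ (j + 1)))
    (hc' : ∀ j : ℕ, μ' j = Measure.map (descend F ℰp j) (μ' (j + 1)))
    {C : ℝ≥0∞} {J : ℕ} (hJ : μ J ≤ C • μ' J) : ∀ j : ℕ, j ≤ J → μ j ≤ C • μ' j := by
  -- induction on the number of steps `k = J − j`
  suffices H : ∀ k j : ℕ, j + k = J → μ j ≤ C • μ' j from
    fun j hj => H (J - j) j (Nat.add_sub_of_le hj)
  intro k
  induction k with
  | zero => intro j hj; rw [Nat.add_zero] at hj; subst hj; exact hJ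
  | succ k ih =>
    intro j hj
    exact descend_step_le_smul F j (hc j) (hc' j) (ih (j + 1) (by omega))

/-! ## §3 From a comparison of measures to a pointwise comparison of densities on an open window -/

/-- **MEASURE COMPARISON ⇒ POINTWISE DENSITY COMPARISON ON AN OPEN SET** for a measure charging open sets: if `ρ·m ≤ e^a·(ρ′·m)` as measures,
`ρ′·m` is finite, `ρ, ρ′` are continuous on the open set `W` and `ρ′ ≥ 0` there, then `ρ ≤ e^a·ρ′` on `W` (no measurability of `ρ, ρ′` is used:
a strict violation persists on an open neighbourhood `O ⊆ W`, whose `ρ·m`-mass would exceed `e^a·(ρ′·m)(O)` by `(δ/2)·m(O) > 0`). [folklore] -/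
theorem le_mul_on_open_of_withDensity_le {Y : Type*} [TopologicalSpace Y] [MeasurableSpace Y] [OpensMeasurableSpace Y]
    (m : Measure Y) [m.IsOpenPosMeasure] {ρ ρ' : Y → ℝ} {a : ℝ} {W : Set Y} (hW : IsOpen W)
    (hρ : ContinuousOn ρ W) (hρ' : ContinuousOn ρ' W) (hpos : ∀ y ∈ W, 0 ≤ ρ' y)
    (hfin : IsFiniteMeasure (m.withDensity (fun y => ENNReal.ofReal (ρ' y))))
    (hle : m.withDensity (fun y => ENNReal.ofReal (ρ y)) ≤
      ENNReal.ofReal (Real.exp a) • m.withDensity (fun y => ENNReal.ofReal (ρ' y))) :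
    ∀ y ∈ W, ρ y ≤ Real.exp a * ρ' y := by
  intro y hy
  by_contra hlt
  rw [not_le] at hlt
  set δ : ℝ := ρ y - Real.exp a * ρ' y with hδ
  have hδpos : 0 < δ := by rw [hδ]; linarith
  -- the violation persists on an open neighbourhood inside `W`
  have hh : ContinuousOn (fun z => ρ z - Real.exp a * ρ' z) W := hρ.sub (continuousOn_const.mul hρ')
  have hev : ∀ᶠ z in 𝓝 y, z ∈ W → δ / 2 < ρ z - Real.exp a * ρ' z := by
    have hat : ContinuousAt (fun z => ρ z - Real.exp a * ρ' z) y := hh.continuousAt (hW.mem_nhds hy)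
    have : ∀ᶠ z in 𝓝 y, δ / 2 < ρ z - Real.exp a * ρ' z :=
      hat.eventually (isOpen_Ioi.mem_nhds (show δ / 2 < ρ y - Real.exp a * ρ' y by rw [← hδ]; linarith))
    exact this.mono fun z hz _ => hz
  obtain ⟨O, hO, hOopen, hyO⟩ := eventually_nhds_iff.mp hev
  set O' : Set Y := O ∩ W with hO'
  have hO'open : IsOpen O' := hOopen.inter hW
  have hO'meas : MeasurableSet O' := hO'open.measurableSet
  have hyO' : y ∈ O' := ⟨hyO, hy⟩
  have hmpos : 0 < m O' := hO'open.measure_pos m ⟨y, hyO'⟩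
  -- lower bound for the `ρ`-mass of `O'`
  have hlow : ENNReal.ofReal (Real.exp a) * (m.withDensity (fun z => ENNReal.ofReal (ρ' z))) O' + ENNReal.ofReal (δ / 2) * m O'
      ≤ (m.withDensity (fun z => ENNReal.ofReal (ρ z))) O' := by
    rw [withDensity_apply _ hO'meas, withDensity_apply _ hO'meas, ← lintegral_const_mul' _ _ ENNReal.ofReal_ne_top,
      ← setLIntegral_const, ← lintegral_add_right _ measurable_const]
    refine setLIntegral_mono' hO'meas fun z hz => ?_
    have hz1 : δ / 2 < ρ z - Real.exp a * ρ' z := hO z hz.1 hz.2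
    have hnn : 0 ≤ Real.exp a * ρ' z := mul_nonneg (Real.exp_pos a).le (hpos z hz.2)
    show ENNReal.ofReal (Real.exp a) * ENNReal.ofReal (ρ' z) + ENNReal.ofReal (δ / 2) ≤ ENNReal.ofReal (ρ z)
    rw [← ENNReal.ofReal_mul (Real.exp_pos a).le, ← ENNReal.ofReal_add hnn (by linarith)]
    exact ENNReal.ofReal_le_ofReal (by linarith)
  -- upper bound from the comparison of measures
  have hup : (m.withDensity (fun z => ENNReal.ofReal (ρ z))) O'
      ≤ ENNReal.ofReal (Real.exp a) * (m.withDensity (fun z => ENNReal.ofReal (ρ' z))) O' := by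
    have := hle O'
    simpa only [Measure.smul_apply, smul_eq_mul] using this
  have hfinO : ENNReal.ofReal (Real.exp a) * (m.withDensity (fun z => ENNReal.ofReal (ρ' z))) O' ≠ ⊤ :=
    ENNReal.mul_ne_top ENNReal.ofReal_ne_top (measure_ne_top _ _)
  have hextra : 0 < ENNReal.ofReal (δ / 2) * m O' :=
    ENNReal.mul_pos (ENNReal.ofReal_pos.mpr (by linarith)).ne' hmpos.ne'
  have := (ENNReal.lt_add_right hfinO hextra.ne').trans_le (hlow.trans hup)
  exact lt_irrefl _ this

/-! ## §4 The rung: one backward step of `stub_lyapunovFR` in the sup-ratio currency, for every consistent pair -/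

/-- **ONE BACKWARD STEP IN THE SUP-RATIO CURRENCY** (crux stmt-QuantumFields-28294 `BackwardStabilityAdmFR`, line «backward-lyapunov»,
`stub_lyapunovFR`'s one-step clause with `ε = C = δ = 0` in the currency `Φ_k := θ·(sup − inf of log ρ_k − log ρ′_k)`): for a CONSISTENT pair of
laws on two consecutive heights of the d = 3 `SU(2)` towers (`μ_j = (descend F ℰp j)_* μ_{j+1}`, same for `μ′`), with Haar densities (route file:
`μ = dU.withDensity (ofReal ∘ ρ)`) that are positive and continuous on the height-`j` window `{PlaqSmall (θBal F.L γ b₀ p₀ j)}` (the crux's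
clauses) and a finite `μ′_j`, an EVERYWHERE two-sided comparison `e^c·ρ′_{j+1} ≤ ρ_{j+1} ≤ e^{c+a}·ρ′_{j+1}` at height `j+1` descends to the
window at height `j` with the same constants.  Applies verbatim to the (P2) toy pair (Wilson runs with finest levels `N`, `N+1`; `J = N`,
`j = N−1`).  The top domination of the crux is NOT available in this currency (header: volume factor `#PBond_J`). [cite: Balaban1985Averaging, (10) p.19] -/
theorem supRatio_oneStep (F : T3Family) (γ b₀ p₀ : ℝ) (j : ℕ)
    (μ₁ μ₁' : Measure (GaugeField (F.P (j + 1)) 0 (Matrix.specialUnitaryGroup (Fin 2) ℂ)))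
    (μ₀ μ₀' : Measure (GaugeField (F.P j) 0 (Matrix.specialUnitaryGroup (Fin 2) ℂ))) [IsFiniteMeasure μ₀] [IsFiniteMeasure μ₀']
    (ρ₁ ρ₁' : GaugeField (F.P (j + 1)) 0 (Matrix.specialUnitaryGroup (Fin 2) ℂ) → ℝ)
    (ρ₀ ρ₀' : GaugeField (F.P j) 0 (Matrix.specialUnitaryGroup (Fin 2) ℂ) → ℝ)
    (hc : μ₀ = Measure.map (descend F ℰp j) μ₁) (hc' : μ₀' = Measure.map (descend F ℰp j) μ₁')
    (hd₁ : μ₁ = (fieldMeasure _ _ _).withDensity (fun U => ENNReal.ofReal (ρ₁ U)))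
    (hd₁' : μ₁' = (fieldMeasure _ _ _).withDensity (fun U => ENNReal.ofReal (ρ₁' U)))
    (hd₀ : μ₀ = (fieldMeasure _ _ _).withDensity (fun V => ENNReal.ofReal (ρ₀ V)))
    (hd₀' : μ₀' = (fieldMeasure _ _ _).withDensity (fun V => ENNReal.ofReal (ρ₀' V)))
    (hpos : ∀ V, PlaqSmall (θBal F.L γ b₀ p₀ j) V → 0 < ρ₀ V ∧ 0 < ρ₀' V)
    (hρ₀ : ContinuousOn ρ₀ {V | PlaqSmall (θBal F.L γ b₀ p₀ j) V}) (hρ₀' : ContinuousOn ρ₀' {V | PlaqSmall (θBal F.L γ b₀ p₀ j) V})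
    {c a : ℝ} (hsup : ∀ U, Real.exp c * ρ₁' U ≤ ρ₁ U ∧ ρ₁ U ≤ Real.exp (c + a) * ρ₁' U) :
    ∀ V, PlaqSmall (θBal F.L γ b₀ p₀ j) V → Real.exp c * ρ₀' V ≤ ρ₀ V ∧ ρ₀ V ≤ Real.exp (c + a) * ρ₀' V := by
  haveI : (fieldMeasure (F.P j) 0 (Matrix.specialUnitaryGroup (Fin 2) ℂ)).IsOpenPosMeasure :=
    B12ContinuousTransportInvariance.isOpenPosMeasure_fieldMeasure_SU 2 (F.P j) 0
  haveI : BorelSpace (GaugeField (F.P j) 0 (Matrix.specialUnitaryGroup (Fin 2) ℂ)) :=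
    inferInstanceAs (BorelSpace (PBond (F.P j) 0 → Matrix.specialUnitaryGroup (Fin 2) ℂ))
  -- the window is open: finitely many strict inequalities between continuous functions ([Balaban1987RG1] (0.18) p.255)
  have hW : IsOpen {V : GaugeField (F.P j) 0 (Matrix.specialUnitaryGroup (Fin 2) ℂ) | PlaqSmall (θBal F.L γ b₀ p₀ j) V} := by
    have h : {V : GaugeField (F.P j) 0 (Matrix.specialUnitaryGroup (Fin 2) ℂ) | PlaqSmall (θBal F.L γ b₀ p₀ j) V} =
        ⋂ p : Plaq (F.P j) 0, {V | dist1 (GaugeField.plaqHol V p) < θBal F.L γ b₀ p₀ j} := by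
      ext V; simp only [PlaqSmall, Set.mem_iInter, Set.mem_setOf_eq]
    rw [h]
    exact isOpen_iInter_of_finite fun p =>
      isOpen_lt ((B12ContinuousTransportInvarianceOn.continuous_dist1_SU (N := 2)).comp
        (B12ContinuousTransportInvarianceOn.continuous_plaqHol_SU p)) continuous_const
  -- upper comparison `μ₀ ≤ e^{c+a} μ₀'`
  have hup₁ : μ₁ ≤ ENNReal.ofReal (Real.exp (c + a)) • μ₁' := by
    rw [hd₁, hd₁']; exact withDensity_ofReal_le_smul _ fun U => (hsup U).2
  have hup₀ : μ₀ ≤ ENNReal.ofReal (Real.exp (c + a)) • μ₀' := descend_step_le_smul F j hc hc' hup₁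
  -- lower comparison, written as `μ₀' ≤ e^{-c} μ₀`
  have hlow₁ : μ₁' ≤ ENNReal.ofReal (Real.exp (-c)) • μ₁ := by
    rw [hd₁, hd₁']
    refine withDensity_ofReal_le_smul _ fun U => ?_
    have h1 := (hsup U).1
    have : Real.exp (-c) * (Real.exp c * ρ₁' U) ≤ Real.exp (-c) * ρ₁ U := mul_le_mul_of_nonneg_left h1 (Real.exp_pos _).le
    rwa [← mul_assoc, ← Real.exp_add, neg_add_cancel, Real.exp_zero, one_mul] at this
  have hlow₀ : μ₀' ≤ ENNReal.ofReal (Real.exp (-c)) • μ₀ := descend_step_le_smul F j hc' hc hlow₁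
  -- pointwise on the window
  have hfin₀ : IsFiniteMeasure ((fieldMeasure (F.P j) 0 (Matrix.specialUnitaryGroup (Fin 2) ℂ)).withDensity
      (fun V => ENNReal.ofReal (ρ₀ V))) := by rw [← hd₀]; infer_instance
  have hfin₀' : IsFiniteMeasure ((fieldMeasure (F.P j) 0 (Matrix.specialUnitaryGroup (Fin 2) ℂ)).withDensity
      (fun V => ENNReal.ofReal (ρ₀' V))) := by rw [← hd₀']; infer_instance
  have hU : ∀ V ∈ {V : GaugeField (F.P j) 0 (Matrix.specialUnitaryGroup (Fin 2) ℂ) | PlaqSmall (θBal F.L γ b₀ p₀ j) V},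
      ρ₀ V ≤ Real.exp (c + a) * ρ₀' V :=
    le_mul_on_open_of_withDensity_le _ hW hρ₀ hρ₀' (fun V hV => (hpos V hV).2.le) hfin₀'
      (by rw [← hd₀, ← hd₀']; exact hup₀)
  have hL : ∀ V ∈ {V : GaugeField (F.P j) 0 (Matrix.specialUnitaryGroup (Fin 2) ℂ) | PlaqSmall (θBal F.L γ b₀ p₀ j) V},
      ρ₀' V ≤ Real.exp (-c) * ρ₀ V :=
    le_mul_on_open_of_withDensity_le _ hW hρ₀' hρ₀ (fun V hV => (hpos V hV).1.le) hfin₀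
      (by rw [← hd₀, ← hd₀']; exact hlow₀)
  intro V hV
  refine ⟨?_, hU V hV⟩
  have h2 := mul_le_mul_of_nonneg_left (hL V hV) (Real.exp_pos c).le
  rwa [← mul_assoc, ← Real.exp_add, add_neg_cancel, Real.exp_zero, one_mul] at h2

/-- **THE READ-OUT: THE LOG-RATIO IS PINNED ON THE WINDOW, SO ITS WINDOW OSCILLATION IS `≤ a`** — under the hypotheses of `supRatio_oneStep`,
`c ≤ log ρ_j V − log ρ′_j V ≤ c + a` for every window datum `V`; hence for ANY two window data (in particular two agreeing off one bond, the crux's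
one-bond read-out shape) `|L_j U − L_j V| ≤ a`: the one-step clause of `stub_lyapunovFR` in the sup-ratio currency, `ε = C = δ = 0`.
[cite: Balaban1985Averaging, (10) p.19] -/
theorem logRatio_window_osc_le_of_supRatio (F : T3Family) (γ b₀ p₀ : ℝ) (j : ℕ)
    (μ₁ μ₁' : Measure (GaugeField (F.P (j + 1)) 0 (Matrix.specialUnitaryGroup (Fin 2) ℂ)))
    (μ₀ μ₀' : Measure (GaugeField (F.P j) 0 (Matrix.specialUnitaryGroup (Fin 2) ℂ))) [IsFiniteMeasure μ₀] [IsFiniteMeasure μ₀']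
    (ρ₁ ρ₁' : GaugeField (F.P (j + 1)) 0 (Matrix.specialUnitaryGroup (Fin 2) ℂ) → ℝ)
    (ρ₀ ρ₀' : GaugeField (F.P j) 0 (Matrix.specialUnitaryGroup (Fin 2) ℂ) → ℝ)
    (hc : μ₀ = Measure.map (descend F ℰp j) μ₁) (hc' : μ₀' = Measure.map (descend F ℰp j) μ₁')
    (hd₁ : μ₁ = (fieldMeasure _ _ _).withDensity (fun U => ENNReal.ofReal (ρ₁ U)))
    (hd₁' : μ₁' = (fieldMeasure _ _ _).withDensity (fun U => ENNReal.ofReal (ρ₁' U)))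
    (hd₀ : μ₀ = (fieldMeasure _ _ _).withDensity (fun V => ENNReal.ofReal (ρ₀ V)))
    (hd₀' : μ₀' = (fieldMeasure _ _ _).withDensity (fun V => ENNReal.ofReal (ρ₀' V)))
    (hpos : ∀ V, PlaqSmall (θBal F.L γ b₀ p₀ j) V → 0 < ρ₀ V ∧ 0 < ρ₀' V)
    (hρ₀ : ContinuousOn ρ₀ {V | PlaqSmall (θBal F.L γ b₀ p₀ j) V}) (hρ₀' : ContinuousOn ρ₀' {V | PlaqSmall (θBal F.L γ b₀ p₀ j) V})
    {c a : ℝ} (hsup : ∀ U, Real.exp c * ρ₁' U ≤ ρ₁ U ∧ ρ₁ U ≤ Real.exp (c + a) * ρ₁' U) :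
    (∀ V, PlaqSmall (θBal F.L γ b₀ p₀ j) V → c ≤ Real.log (ρ₀ V) - Real.log (ρ₀' V) ∧ Real.log (ρ₀ V) - Real.log (ρ₀' V) ≤ c + a) ∧
    (∀ (b : PBond (F.P j) 0) (U V : GaugeField (F.P j) 0 (Matrix.specialUnitaryGroup (Fin 2) ℂ)),
      PlaqSmall (θBal F.L γ b₀ p₀ j) U → PlaqSmall (θBal F.L γ b₀ p₀ j) V → (∀ e, e ≠ b → U e = V e) →
      |(Real.log (ρ₀ U) - Real.log (ρ₀' U)) - (Real.log (ρ₀ V) - Real.log (ρ₀' V))| ≤ a) := by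
  have hstep := supRatio_oneStep F γ b₀ p₀ j μ₁ μ₁' μ₀ μ₀' ρ₁ ρ₁' ρ₀ ρ₀' hc hc' hd₁ hd₁' hd₀ hd₀' hpos hρ₀ hρ₀' hsup
  have hpin : ∀ V, PlaqSmall (θBal F.L γ b₀ p₀ j) V →
      c ≤ Real.log (ρ₀ V) - Real.log (ρ₀' V) ∧ Real.log (ρ₀ V) - Real.log (ρ₀' V) ≤ c + a := by
    intro V hV
    obtain ⟨h1, h2⟩ := hstep V hV
    obtain ⟨hρ, hρ'⟩ := hpos V hV
    constructor
    · have := Real.log_le_log (mul_pos (Real.exp_pos c) hρ') h1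
      rw [Real.log_mul (Real.exp_pos c).ne' hρ'.ne', Real.log_exp] at this
      linarith
    · have := Real.log_le_log hρ h2
      rw [Real.log_mul (Real.exp_pos _).ne' hρ'.ne', Real.log_exp] at this
      linarith
  refine ⟨hpin, fun b U V hU hV _hUV => ?_⟩
  obtain ⟨hU1, hU2⟩ := hpin U hU
  obtain ⟨hV1, hV2⟩ := hpin V hV
  rw [abs_le]
  constructor <;> linarith

/-! ## §5 The (P2) toy pair by name: the Wilson runs with finest levels `N = j+1` and `N+1`, one backward step `N → N−1 = j` -/

/-- **THE TOY PAIR OF THE LINE CARD, ONE BACKWARD STEP, SUP-RATIO CURRENCY** (Cruxes/BackwardStabilityAdmFR/Lines/birth.md (P2): the two Wilson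
runs with finest levels `N` and `N+1` read at the common heights, top `J := N`; here `N = j+1` and the step is `J → J−1`): the laws are
`μ_{j+1} := gibbsK F ℰp γ (j+1)` (run `N` at its finest level, [Balaban1985UV3] (1) p.256), `μ′_{j+1} := (descend F ℰp (j+1))_* gibbsK F ℰp γ (j+2)`
(run `N+1` after ONE renormalisation step, (2) p.256), and their one-step descents to height `j`; consistency holds BY CONSTRUCTION, the laws are
probability measures (`γ ≥ 0`), and for ANY Haar densities presenting them as in the crux's frame (positive and continuous on the height-`j`
window) an everywhere comparison `e^c ρ′ ≤ ρ ≤ e^{c+a} ρ′` at height `j+1` descends to the window at height `j`, where the log-ratio is pinned in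
`[c, c+a]` and its one-bond oscillation is `≤ a`.  HONEST: the available `a` for this pair in this currency is of the size of the actions
(`∼ β_{j+1}·#Plaq_{j+1}`), not of the clustered rate `ω_J` — the census line of the header. [cite: Balaban1985UV3, (1)-(3) p.256] -/
theorem toyPair_supRatio_oneStep (F : T3Family) (γ b₀ p₀ : ℝ) (hγ : 0 ≤ γ) (j : ℕ)
    (ρ₁ ρ₁' : GaugeField (F.P (j + 1)) 0 (Matrix.specialUnitaryGroup (Fin 2) ℂ) → ℝ)
    (ρ₀ ρ₀' : GaugeField (F.P j) 0 (Matrix.specialUnitaryGroup (Fin 2) ℂ) → ℝ)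
    (hd₁ : gibbsK F ℰp γ (j + 1) = (fieldMeasure _ _ _).withDensity (fun U => ENNReal.ofReal (ρ₁ U)))
    (hd₁' : Measure.map (descend F ℰp (j + 1)) (gibbsK F ℰp γ (j + 1 + 1)) =
      (fieldMeasure _ _ _).withDensity (fun U => ENNReal.ofReal (ρ₁' U)))
    (hd₀ : Measure.map (descend F ℰp j) (gibbsK F ℰp γ (j + 1)) = (fieldMeasure _ _ _).withDensity (fun V => ENNReal.ofReal (ρ₀ V)))
    (hd₀' : Measure.map (descend F ℰp j) (Measure.map (descend F ℰp (j + 1)) (gibbsK F ℰp γ (j + 1 + 1))) =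
      (fieldMeasure _ _ _).withDensity (fun V => ENNReal.ofReal (ρ₀' V)))
    (hpos : ∀ V, PlaqSmall (θBal F.L γ b₀ p₀ j) V → 0 < ρ₀ V ∧ 0 < ρ₀' V)
    (hρ₀ : ContinuousOn ρ₀ {V | PlaqSmall (θBal F.L γ b₀ p₀ j) V}) (hρ₀' : ContinuousOn ρ₀' {V | PlaqSmall (θBal F.L γ b₀ p₀ j) V})
    {c a : ℝ} (hsup : ∀ U, Real.exp c * ρ₁' U ≤ ρ₁ U ∧ ρ₁ U ≤ Real.exp (c + a) * ρ₁' U) :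
    (∀ V, PlaqSmall (θBal F.L γ b₀ p₀ j) V → c ≤ Real.log (ρ₀ V) - Real.log (ρ₀' V) ∧ Real.log (ρ₀ V) - Real.log (ρ₀' V) ≤ c + a) ∧
    (∀ (b : PBond (F.P j) 0) (U V : GaugeField (F.P j) 0 (Matrix.specialUnitaryGroup (Fin 2) ℂ)),
      PlaqSmall (θBal F.L γ b₀ p₀ j) U → PlaqSmall (θBal F.L γ b₀ p₀ j) V → (∀ e, e ≠ b → U e = V e) →
      |(Real.log (ρ₀ U) - Real.log (ρ₀' U)) - (Real.log (ρ₀ V) - Real.log (ρ₀' V))| ≤ a) := by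
  haveI h1 : IsProbabilityMeasure (gibbsK F ℰp γ (j + 1)) :=
    T4GenFunBounds.isProbabilityMeasure_gibbsMeasure _ (F.scheme_β_nonneg ℰp hγ _)
  haveI h2 : IsProbabilityMeasure (gibbsK F ℰp γ (j + 1 + 1)) :=
    T4GenFunBounds.isProbabilityMeasure_gibbsMeasure _ (F.scheme_β_nonneg ℰp hγ _)
  haveI : IsFiniteMeasure (Measure.map (descend F ℰp j) (gibbsK F ℰp γ (j + 1))) := inferInstance
  haveI : IsFiniteMeasure (Measure.map (descend F ℰp j) (Measure.map (descend F ℰp (j + 1)) (gibbsK F ℰp γ (j + 1 + 1)))) :=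
    inferInstance
  exact logRatio_window_osc_le_of_supRatio F γ b₀ p₀ j (gibbsK F ℰp γ (j + 1))
    (Measure.map (descend F ℰp (j + 1)) (gibbsK F ℰp γ (j + 1 + 1))) _ _ ρ₁ ρ₁' ρ₀ ρ₀' rfl rfl hd₁ hd₁' hd₀ hd₀' hpos hρ₀ hρ₀' hsup


/-! ## §6 (appended, rung 1b) The a.e. form of the density comparison — densities are a.e.-defined objects -/

/-- `ρ ≤ e^a·ρ′` `m`-ALMOST EVERYWHERE already gives `ρ·m ≤ e^a·(ρ′·m)`. [folklore] -/
theorem withDensity_ofReal_le_smul_ae {X : Type*} [MeasurableSpace X] (m : Measure X) {ρ ρ' : X → ℝ} {a : ℝ}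
    (h : ∀ᵐ x ∂m, ρ x ≤ Real.exp a * ρ' x) :
    m.withDensity (fun x => ENNReal.ofReal (ρ x)) ≤
      ENNReal.ofReal (Real.exp a) • m.withDensity (fun x => ENNReal.ofReal (ρ' x)) := by
  rw [← withDensity_smul' _ _ ENNReal.ofReal_ne_top]
  refine withDensity_mono (h.mono fun x hx => ?_)
  show ENNReal.ofReal (ρ x) ≤ ENNReal.ofReal (Real.exp a) * ENNReal.ofReal (ρ' x)
  rw [← ENNReal.ofReal_mul (Real.exp_pos a).le]
  exact ENNReal.ofReal_le_ofReal hx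

/-! ## §7 (appended, rung 1b) Large fields: a window comparison MODULO A TAIL MASS descends at the level of measures, WITHOUT accumulation -/

/-- **WINDOW COMPARISON + TAIL ⇒ PER-SET COMPARISON OF THE PUSH-FORWARDS**: if `μ ≤ C·μ′` on (the restriction to) a set `S` and `μ(Sᶜ) ≤ η`, then for
every measurable `B`, `(d_*μ)(B) ≤ C·(d_*μ′)(B) + η`.  (One backward step with large fields: the comparison is known only on the window `S_{j+1}`, the
complement carries mass `≤ η_{j+1}`.) [cite: Balaban1985Averaging, (10) p.19] -/
theorem map_apply_le_of_restrict_le {X Y : Type*} [MeasurableSpace X] [MeasurableSpace Y] {μ μ' : Measure X} {d : X → Y}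
    (hd : Measurable d) {S : Set X} {C η : ℝ≥0∞} (hS : μ.restrict S ≤ C • μ'.restrict S) (htail : μ Sᶜ ≤ η)
    {B : Set Y} (hB : MeasurableSet B) : μ.map d B ≤ C * μ'.map d B + η := by
  rw [Measure.map_apply hd hB, Measure.map_apply hd hB]
  have hsplit : μ (d ⁻¹' B) ≤ μ (d ⁻¹' B ∩ S) + μ Sᶜ := by
    calc μ (d ⁻¹' B) ≤ μ (d ⁻¹' B ∩ S ∪ Sᶜ) := measure_mono fun x hx => by
            by_cases hxS : x ∈ S
            · exact Or.inl ⟨hx, hxS⟩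
            · exact Or.inr hxS
      _ ≤ μ (d ⁻¹' B ∩ S) + μ Sᶜ := measure_union_le _ _
  have hwin : μ (d ⁻¹' B ∩ S) ≤ C * μ' (d ⁻¹' B) := by
    have h1 : μ (d ⁻¹' B ∩ S) = μ.restrict S (d ⁻¹' B) := (Measure.restrict_apply (hd hB)).symm
    have h2 : (C • μ'.restrict S) (d ⁻¹' B) = C * μ' (d ⁻¹' B ∩ S) := by
      rw [Measure.smul_apply, smul_eq_mul, Measure.restrict_apply (hd hB)]
    calc μ (d ⁻¹' B ∩ S) = μ.restrict S (d ⁻¹' B) := h1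
      _ ≤ (C • μ'.restrict S) (d ⁻¹' B) := hS _
      _ = C * μ' (d ⁻¹' B ∩ S) := h2
      _ ≤ C * μ' (d ⁻¹' B) := mul_le_mul' le_rfl (measure_mono Set.inter_subset_left)
  calc μ (d ⁻¹' B) ≤ μ (d ⁻¹' B ∩ S) + μ Sᶜ := hsplit
    _ ≤ C * μ' (d ⁻¹' B) + η := add_le_add hwin htail

/-- **PER-SET COMPARISONS WITH AN ADDITIVE ERROR ARE INHERITED BY PUSH-FORWARDS, WITH THE SAME CONSTANTS** (no accumulation of the additive error
down a consistent tower: the tail mass is paid ONCE, at the height where the window comparison was read). [cite: Balaban1985Averaging, (10) p.19] -/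
theorem map_apply_le_of_apply_le {X Y : Type*} [MeasurableSpace X] [MeasurableSpace Y] {μ μ' : Measure X} {d : X → Y}
    (hd : Measurable d) {C η : ℝ≥0∞} (h : ∀ A : Set X, MeasurableSet A → μ A ≤ C * μ' A + η)
    {B : Set Y} (hB : MeasurableSet B) : μ.map d B ≤ C * μ'.map d B + η := by
  rw [Measure.map_apply hd hB, Measure.map_apply hd hB]
  exact h _ (hd hB)

/-- **DOWN A WHOLE TOWER, MODULO THE TOP TAIL**: along consistent towers, a per-set comparison `μ_J(A) ≤ C·μ′_J(A) + η` at the top height descends to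
EVERY height `j ≤ J` with the SAME `C` and the SAME `η`. [cite: Balaban1985Averaging, (10) p.19] -/
theorem tower_apply_le (F : T3Family)
    (μ μ' : (j : ℕ) → Measure (GaugeField (F.P j) 0 (Matrix.specialUnitaryGroup (Fin 2) ℂ)))
    (hc : ∀ j : ℕ, μ j = Measure.map (descend F ℰp j) (μ (j + 1)))
    (hc' : ∀ j : ℕ, μ' j = Measure.map (descend F ℰp j) (μ' (j + 1)))
    {C η : ℝ≥0∞} {J : ℕ} (hJ : ∀ A, MeasurableSet A → μ J A ≤ C * μ' J A + η) :
    ∀ j : ℕ, j ≤ J → ∀ B, MeasurableSet B → μ j B ≤ C * μ' j B + η := by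
  suffices H : ∀ k j : ℕ, j + k = J → ∀ B, MeasurableSet B → μ j B ≤ C * μ' j B + η from
    fun j hj => H (J - j) j (Nat.add_sub_of_le hj)
  intro k
  induction k with
  | zero => intro j hj; rw [Nat.add_zero] at hj; subst hj; exact hJ
  | succ k ih =>
    intro j hj B hB
    rw [hc j, hc' j]
    exact map_apply_le_of_apply_le (measurable_descend F ℰp measurableE_ℰp j) (ih (j + 1) (by omega)) hB

/-- **THE LARGE-FIELD FORM OF THE BACKWARD STEP, AT THE LEVEL OF MEASURES** (crux vocabulary): if at the top height `J` the densities are comparable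
ON THE WINDOW, `ρ_J ≤ e^{a}·ρ′_J` on `{PlaqSmall (θBal … J)}`, and the window complement has `μ_J`-mass `≤ η` (the crux's tail clause), then at every
height `j ≤ J` of the consistent towers and for every measurable `B`: `μ_j(B) ≤ e^{a}·μ′_j(B) + η` — the tail is paid once, the constant is unchanged.
HONEST CENSUS: this per-set form CANNOT be upgraded to the crux's pointwise window read-out at height `j` (an additive mass `η_J ≈ e^{−p(g_J)²∕4}` is
enormous against the Haar volume `≈ θ_j^{3·#PBond_j}` of a window-scale ball, so `le_mul_on_open_of_withDensity_le` has no analogue with tails):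
this is exactly why the route types the tails in the FLOOR CLASS and why the class structure ([Balaban1985UV3] (41)∕(47): the large-field parts are
carried as explicit terms of the density, not as mass bounds) is needed for the one-bond currency. [cite: Balaban1985UV3, (41)-(47) pp.266-267] -/
theorem window_comparison_descends_modulo_tail (F : T3Family) (γ b₀ p₀ : ℝ)
    (μ μ' : (j : ℕ) → Measure (GaugeField (F.P j) 0 (Matrix.specialUnitaryGroup (Fin 2) ℂ)))
    (ρ ρ' : (j : ℕ) → GaugeField (F.P j) 0 (Matrix.specialUnitaryGroup (Fin 2) ℂ) → ℝ)
    (hc : ∀ j : ℕ, μ j = Measure.map (descend F ℰp j) (μ (j + 1)))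
    (hc' : ∀ j : ℕ, μ' j = Measure.map (descend F ℰp j) (μ' (j + 1)))
    (J : ℕ) (hd : μ J = (fieldMeasure _ _ _).withDensity (fun U => ENNReal.ofReal (ρ J U)))
    (hd' : μ' J = (fieldMeasure _ _ _).withDensity (fun U => ENNReal.ofReal (ρ' J U)))
    {a η : ℝ} (hwin : ∀ U, PlaqSmall (θBal F.L γ b₀ p₀ J) U → ρ J U ≤ Real.exp a * ρ' J U)
    (htail : μ J {U | ¬ PlaqSmall (θBal F.L γ b₀ p₀ J) U} ≤ ENNReal.ofReal η) :
    ∀ j : ℕ, j ≤ J → ∀ B, MeasurableSet B → μ j B ≤ ENNReal.ofReal (Real.exp a) * μ' j B + ENNReal.ofReal η := by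
  have hS : MeasurableSet {U : GaugeField (F.P J) 0 (Matrix.specialUnitaryGroup (Fin 2) ℂ) | PlaqSmall (θBal F.L γ b₀ p₀ J) U} :=
    measurableSet_plaqSmall _
  -- the window comparison as a comparison of restricted measures
  have hres : (μ J).restrict {U | PlaqSmall (θBal F.L γ b₀ p₀ J) U} ≤
      ENNReal.ofReal (Real.exp a) • (μ' J).restrict {U | PlaqSmall (θBal F.L γ b₀ p₀ J) U} := by
    rw [hd, hd', restrict_withDensity hS, restrict_withDensity hS]
    exact withDensity_ofReal_le_smul_ae _ (ae_restrict_of_forall_mem hS fun U hU => hwin U hU)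
  have hcompl : {U : GaugeField (F.P J) 0 (Matrix.specialUnitaryGroup (Fin 2) ℂ) | PlaqSmall (θBal F.L γ b₀ p₀ J) U}ᶜ =
      {U | ¬ PlaqSmall (θBal F.L γ b₀ p₀ J) U} := by ext U; simp
  -- top height: per-set comparison modulo the tail (restrict to `A`, no push-forward needed: use `d = id` through `map_id`)
  have htop : ∀ A, MeasurableSet A → μ J A ≤ ENNReal.ofReal (Real.exp a) * μ' J A + ENNReal.ofReal η := by
    intro A hA
    have htail' : μ J {U : GaugeField (F.P J) 0 (Matrix.specialUnitaryGroup (Fin 2) ℂ) | PlaqSmall (θBal F.L γ b₀ p₀ J) U}ᶜ ≤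
        ENNReal.ofReal η := by rw [hcompl]; exact htail
    have h := map_apply_le_of_restrict_le (μ := μ J) (μ' := μ' J) (d := id) (η := ENNReal.ofReal η) measurable_id hres htail' hA
    simpa only [Measure.map_id] using h
  exact tower_apply_le F μ μ' hc hc' htop

end Summit.QuantumFields.YangMills.Theorems.BackwardLiouvilleRigidity.SupRatioStep
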